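import Mathlib.AlgebraicGeometry.Morphisms.Etale
import Mathlib.AlgebraicGeometry.Morphisms.Finite
import Mathlib.CategoryTheory.Monoidal.Cartesian.Over
import HarnessLib

/-!
# Finite fibre powers of a finite étale `S`-scheme, with their universal property (existence form)

Layer `Literature/AlgebraicGeometry/Morphisms`, namespace `Literature.AlgebraicGeometry.Morphisms`.  Cell `hodgecm-mathlib`
(D-0151), F-DAG (h9-S) (W3) cover / F-6 (IV) / F-10 (b) consumer: the finite étale `S`-scheme of ordered `ℤ/M`-bases
`B_M(A) ⊆ A[M]^{×_S 2g}` needs the `2g`-fold fibre power of the finite étale `A[M] → S`.  Author B-p02 (g12); count-neutral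
capital, PROOF lane, theorems only (no `def`): the power is delivered as an EXISTENCE statement with its universal
property, built by iterating the cartesian-monoidal product of `Over S` (Mathlib `CartesianMonoidalCategory (Over S)`:
`X ⊗ T = X ×_S T`, `(X ⊗ T).hom = pr₁ ≫ X.hom`, `Over.tensorObj_hom`), so that no new object enters the tree.
HC_CM is proved only modulo the 7 printed citations until rung 0 closes; this file asserts nothing about HC.

## What is proved

* `exists_finPower_finite_etale` — for `X ∈ Over S` with `X → S` finite étale and `k : ℕ`, there are `T ∈ Over S` with
  `T → S` FINITE ÉTALE and projections `π i : T ⟶ X` (`i : Fin k`) such that every family `x : Fin k → (T' ⟶ X)` of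
  `S`-morphisms factors as `u ≫ π i = x i` for a UNIQUE `u : T' ⟶ T` ([GortzWedhorn2020] (4.7): fibre products over `S`;
  finite / étale are stable under base change and composition, Mathlib instances);
* `exists_power_finite_etale` — the same indexed by an arbitrary finite type `ι`.

## References
* [GortzWedhorn2020] U. Görtz, T. Wedhorn, *Algebraic Geometry I*, 2nd ed. (2020), Section (4.7), (4.7.1) (p. 108);
  Prop. 12.11 (finite morphisms are stable under base change and composition).
* [GortzWedhorn2023] U. Görtz, T. Wedhorn, *Algebraic Geometry II* (2023), Def. 18.34 / Prop. 18.36 (étale morphisms: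
  base change and composition).
-/

noncomputable section

universe u

open CategoryTheory CategoryTheory.Limits AlgebraicGeometry MonoidalCategory CartesianMonoidalCategory

namespace Literature.AlgebraicGeometry.Morphisms

variable {S : Scheme.{u}} (X : Over S)

/-- The structure map of the monoidal unit of `Over S` is `𝟙 S`: finite and étale. [cite: GortzWedhorn2020, Section (4.7), (4.7.1) (p. 108)] -/
theorem isFinite_and_etale_tensorUnit_hom : IsFinite (𝟙_ (Over S)).hom ∧ Etale (𝟙_ (Over S)).hom := by
  change IsFinite (𝟙 S) ∧ Etale (𝟙 S)
  exact ⟨inferInstance, inferInstance⟩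

/-- `X ×_S T → S` is finite étale if `X → S` and `T → S` are (base change + composition).
[cite: GortzWedhorn2020, Prop. 12.11] [cite: GortzWedhorn2023, Def. 18.34 and Prop. 18.36] -/
theorem isFinite_and_etale_tensorObj_hom (T : Over S) [IsFinite X.hom] [Etale X.hom] [IsFinite T.hom] [Etale T.hom] :
    IsFinite (X ⊗ T).hom ∧ Etale (X ⊗ T).hom := by
  change IsFinite (pullback.fst X.hom T.hom ≫ X.hom) ∧ Etale (pullback.fst X.hom T.hom ≫ X.hom)
  exact ⟨inferInstance, inferInstance⟩

/-- **Finite fibre powers of a finite étale `S`-scheme (existence with universal property).**  For `X → S` finite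
étale and `k : ℕ` there is a FINITE ÉTALE `T → S` with `k` projections `π i : T → X` over `S` through which every
`k`-tuple of `S`-morphisms `T' → X` factors uniquely — the `k`-fold fibre power `X ×_S ⋯ ×_S X`, built as the iterated
product `X ⊗ (X ⊗ ⋯)` of the cartesian-monoidal `Over S`. [cite: GortzWedhorn2020, Section (4.7), (4.7.1) (p. 108)]
[cite: GortzWedhorn2020, Prop. 12.11] -/
theorem exists_finPower_finite_etale [IsFinite X.hom] [Etale X.hom] (k : ℕ) :
    ∃ (T : Over S) (π : Fin k → (T ⟶ X)), IsFinite T.hom ∧ Etale T.hom ∧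
      (∀ (T' : Over S) (x : Fin k → (T' ⟶ X)), ∃ u : T' ⟶ T, ∀ i, u ≫ π i = x i) ∧
        ∀ (T' : Over S) (u v : T' ⟶ T), (∀ i, u ≫ π i = v ≫ π i) → u = v := by
  induction k with
  | zero =>
    refine ⟨𝟙_ (Over S), Fin.elim0, isFinite_and_etale_tensorUnit_hom.1, isFinite_and_etale_tensorUnit_hom.2,
      fun T' x => ⟨toUnit T', fun i => i.elim0⟩, fun T' u v _ => Subsingleton.elim u v⟩
  | succ k ih =>
    obtain ⟨T, π, hfin, het, hex, huniq⟩ := ih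
    haveI := hfin
    haveI := het
    refine ⟨X ⊗ T, Fin.cons (fst X T) (fun i => snd X T ≫ π i), (isFinite_and_etale_tensorObj_hom X T).1,
      (isFinite_and_etale_tensorObj_hom X T).2, fun T' x => ?_, fun T' u v h => ?_⟩
    · obtain ⟨u, hu⟩ := hex T' (fun i => x i.succ)
      refine ⟨lift (x 0) u, fun i => ?_⟩
      refine Fin.cases ?_ (fun j => ?_) i
      · rw [Fin.cons_zero, lift_fst]
      · rw [Fin.cons_succ, lift_snd_assoc, hu]
    · apply CartesianMonoidalCategory.hom_ext
      · have h0 := h 0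
        rwa [Fin.cons_zero] at h0
      · refine huniq T' _ _ fun i => ?_
        have hi := h i.succ
        rwa [Fin.cons_succ, ← Category.assoc, ← Category.assoc] at hi

/-- **Finite fibre powers indexed by any finite type** (transport of `exists_finPower_finite_etale` along
`ι ≃ Fin k`). [cite: GortzWedhorn2020, Section (4.7), (4.7.1) (p. 108)] -/
theorem exists_power_finite_etale [IsFinite X.hom] [Etale X.hom] (ι : Type) [Finite ι] :
    ∃ (T : Over S) (π : ι → (T ⟶ X)), IsFinite T.hom ∧ Etale T.hom ∧
      (∀ (T' : Over S) (x : ι → (T' ⟶ X)), ∃ u : T' ⟶ T, ∀ i, u ≫ π i = x i) ∧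
        ∀ (T' : Over S) (u v : T' ⟶ T), (∀ i, u ≫ π i = v ≫ π i) → u = v := by
  obtain ⟨k, ⟨e⟩⟩ := Finite.exists_equiv_fin ι
  obtain ⟨T, π, hfin, het, hex, huniq⟩ := exists_finPower_finite_etale X k
  refine ⟨T, fun j => π (e j), hfin, het, fun T' x => ?_, fun T' u v h => huniq T' u v fun i => ?_⟩
  · obtain ⟨u, hu⟩ := hex T' (fun i => x (e.symm i))
    exact ⟨u, fun j => by rw [hu, Equiv.symm_apply_apply]⟩
  · have := h (e.symm i)
    dsimp only at this
    rwa [Equiv.apply_symm_apply] at this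

end Literature.AlgebraicGeometry.Morphisms

end
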